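import Summits.Ventures.DiscreteObjects.Hadamard.AutomorphismTransfer668
import Summits.Ventures.DiscreteObjects.UnitDistance.UnitCircleGraph
import Mathlib.Analysis.InnerProductSpace.PiL2
import HarnessLib

/-!
# Runbook sanity lemmas for the named-objects census (cell `pub-namedobj`) — non-vacuity / agreement rows of REVIEW-RUNBOOK card (2)(b)

Framing (verbatim for the cell): lottery ticket; floor = certified bounds/negative ranges.

Written by the ops-runbook seat for the human REVIEW-RUNBOOK of the cell's kernel headlines
(`Hadamard.hadamard668_signedAut_prime_mem'`, `STD.prime_order_atlas`, `PP12.Collineation.prime_order_atlas_order12`,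
`UnitDistance.chromaticNumber_unitCircleGraph_zmod3/_zmod7`, `Mahler.height1SubLehmerEmptyUpTo_56_iff`).  Nothing here is a
claim about the census rows; these are the small explicit checks a referee would otherwise do by hand:

* `IsHadamardMatrix` (the predicate every H(668) theorem quantifies over) is INHABITED at order 2 (`isHadamardMatrix_sylvester2`, the Sylvester matrix `[[1,1],[1,-1]]` written as a literal)
  and NOT trivially true (`not_isHadamardMatrix_ones2`); `IsSignedAut` admits a NON-identity automorphism of prime order 2 on that
  witness (`isSignedAut_sylvester2_swap`, `swap2_sq`, `swap2_ne_one`) — i.e. the hypothesis telescope of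
  `hadamard668_signedAut_prime_mem'` MINUS the size hypothesis `Fintype.card ι = 668` is jointly satisfiable (with `p = 2`, a member of
  the concluded spectrum).  WHAT CANNOT BE WITNESSED, and why: the full telescope including `Fintype.card ι = 668` — whether a Hadamard
  matrix of order 668 exists is exactly the open problem the census attacks (smallest open order); the theorem is a constraint on a
  hypothetical object and is advertised as such.
* `unitCircleGraph` AGREES with the Euclidean unit distance of Mathlib on the real plane (`unitCircleGraph_real_adj_iff_dist`:
  adjacency of `(p 0, p 1)` and `(q 0, q 1)` ↔ `dist p q = 1` in `EuclideanSpace ℝ (Fin 2)`), and over `ZMod 3` it is neither empty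
  nor complete (`unitCircleGraph_zmod3_adj_example`, `unitCircleGraph_zmod3_not_adj_example`).
-/

namespace Summit.Ventures.DiscreteObjects.Runbook

open Literature.Combinatorics.Designs.GoethalsSeidel (IsHadamardMatrix)
open Summit.Ventures.DiscreteObjects.Hadamard (IsSignedAut)
open Summit.Ventures.DiscreteObjects.UnitDistance (unitCircleGraph unitCircleGraph_adj ne_of_sq_add_sq_eq_one)

/-- Non-vacuity of `IsHadamardMatrix`: the order-2 Sylvester matrix is a Hadamard matrix (`±1` entries, `H Hᵀ = 2·I`). [folklore] -/
theorem isHadamardMatrix_sylvester2 : IsHadamardMatrix (!![1, 1; 1, -1] : Matrix (Fin 2) (Fin 2) ℤ) := by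
  unfold IsHadamardMatrix
  decide

/-- `IsHadamardMatrix` is not trivially true: the all-ones `2 × 2` matrix has `±1` entries but non-orthogonal rows. [folklore] -/
theorem not_isHadamardMatrix_ones2 : ¬ IsHadamardMatrix (Matrix.of fun (_ _ : Fin 2) => (1 : ℤ)) := by
  unfold IsHadamardMatrix
  decide

/-- Non-vacuity of `IsSignedAut` beyond the identity: swapping the two columns of `sylvester2` and negating its second row
is a signed-permutation automorphism (`π = 1`, `κ = swap 0 1`, `d = (1, -1)`, `e = (1, 1)`). [folklore] -/
theorem isSignedAut_sylvester2_swap :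
    IsSignedAut (!![1, 1; 1, -1] : Matrix (Fin 2) (Fin 2) ℤ) 1 (Equiv.swap 0 1) ![1, -1] ![1, 1] := by
  unfold IsSignedAut
  decide

/-- The column permutation of `isSignedAut_sylvester2_swap` has prime order: `(swap 0 1)² = 1` … [folklore] -/
theorem swap2_sq : (Equiv.swap (0 : Fin 2) 1) ^ 2 = 1 := by
  decide

/-- … and is not the identity, so `(π, κ) ≠ (1, 1)` — every hypothesis of `hadamard668_signedAut_prime_mem'` except
`Fintype.card ι = 668` holds on this order-2 witness with `p = 2`. [folklore] -/
theorem swap2_ne_one : (Equiv.swap (0 : Fin 2) 1) ≠ 1 := by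
  decide

/-- Joint satisfiability, packaged: an order-2 Hadamard matrix with a non-identity signed automorphism whose permutations
square to the identity (the size hypothesis `card = 668` is the only one not met — that order's existence is open). [folklore] -/
theorem hadamard_signedAut_hypotheses_satisfiable_order2 :
    ∃ (H : Matrix (Fin 2) (Fin 2) ℤ) (π κ : Equiv.Perm (Fin 2)) (d e : Fin 2 → ℤ),
      IsHadamardMatrix H ∧ IsSignedAut H π κ d e ∧ π ^ 2 = 1 ∧ κ ^ 2 = 1 ∧ (π ≠ 1 ∨ κ ≠ 1) :=
  ⟨!![1, 1; 1, -1], 1, Equiv.swap 0 1, ![1, -1], ![1, 1], isHadamardMatrix_sylvester2, isSignedAut_sylvester2_swap,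
    one_pow 2, swap2_sq, Or.inr swap2_ne_one⟩

/-- `unitCircleGraph (ZMod 3)` has an edge: `(0,0) ~ (1,0)` (difference `(−1, 0)`, `1 + 0 = 1`). [folklore] -/
theorem unitCircleGraph_zmod3_adj_example : (unitCircleGraph (ZMod 3)).Adj ((0 : ZMod 3), (0 : ZMod 3)) (1, 0) := by
  rw [unitCircleGraph_adj]
  decide

/-- … and a non-edge: `(0,0) ≁ (1,1)` (difference `(−1, −1)`, `1 + 1 = 2 ≠ 1` in `ZMod 3`). [folklore] -/
theorem unitCircleGraph_zmod3_not_adj_example : ¬ (unitCircleGraph (ZMod 3)).Adj ((0 : ZMod 3), (0 : ZMod 3)) (1, 1) := by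
  rw [unitCircleGraph_adj]
  decide

/-- Agreement with Mathlib's Euclidean distance: on the real plane, adjacency in `unitCircleGraph ℝ` of the coordinate pairs
of `p q : EuclideanSpace ℝ (Fin 2)` is exactly `dist p q = 1` (the unit-distance graph of the plane). [folklore] -/
theorem unitCircleGraph_real_adj_iff_dist (p q : EuclideanSpace ℝ (Fin 2)) :
    (unitCircleGraph ℝ).Adj (p 0, p 1) (q 0, q 1) ↔ dist p q = 1 := by
  rw [unitCircleGraph_adj, EuclideanSpace.dist_eq]
  simp only [Real.dist_eq, sq_abs, Fin.sum_univ_two]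
  have hnn : 0 ≤ (p 0 - q 0) ^ 2 + (p 1 - q 1) ^ 2 := by positivity
  constructor
  · rintro ⟨-, h⟩
    rw [h, Real.sqrt_one]
  · intro h
    have h1 : (p 0 - q 0) ^ 2 + (p 1 - q 1) ^ 2 = 1 := by
      have hs := Real.sq_sqrt hnn
      rw [h, one_pow] at hs
      exact hs.symm
    exact ⟨ne_of_sq_add_sq_eq_one h1, h1⟩

end Summit.Ventures.DiscreteObjects.Runbook
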